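import Literature.AlgebraicGeometry.Motives.DiagonalHypersurfaceFiniteFieldCohomology
import HarnessLib

/-!
# Frobenius on the cohomology of the diagonal hypersurface `X = V₊(Σ βᵢ xᵢ^d) ⊂ ℙⁿ⁺¹_{𝔽_q}` (`d ∣ q − 1`):
# `F = q^{i/2}` on `Hⁱ(X)` (`i ≠ n`), and the reciprocal roots of `det(1 − FT | Hⁿ(X))` ARE Weil's Jacobi sums

Topic `Literature/AlgebraicGeometry/Motives`; THEOREMS ONLY (no definition, no instance, no named fact; D-0026).
Sequel of `Motives/DiagonalHypersurfaceFiniteFieldCohomology` (g49-#5: Betti numbers `bᵢ = [i even]` off the middle,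
`Pᵢ(X,T) = 1 − q^{i/2}T`, and `Pₙ = (1 − q^{n/2}T)^{[n even]}·P` with `P ↦ Π(1 − αT)` over an UNSPECIFIED multiset of
Weil numbers) and of `Motives/ZetaFunctionOfDiagonalHypersurface` (g49-#2: `Z(X,T)·Π_{j≤n}(1 − qʲT) = P(T)^{±1}` with
`P(T) = Π_{a∈𝓐}(1 − α_aT)` EXPLICITLY, `α_a = (−1)ⁿ Πᵢχ^{aᵢ}(βᵢ⁻¹)·J₀(χ^{a₀},…,χ^{a_{n+1}})`, over any field containing
the character values).  This file closes the gap between the two: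

* §1 (scheme level) **`weil1949Numerator_map_eq`** — ANY integer polynomial `P₁` with Weil's identity
  `Z·Π_{j≤n}(1 − qʲT) = P₁^{±1}` satisfies `P₁ ↦ Π_{a∈𝓐}(1 − α_aT)` in `ℂ[T]`, for every complex character `χ` of
  exact order `d` and every `ψ ≠ 1`; hence **`IsWeilFactorization.map_middle_eq_of_diagonalHypersurface`**: for
  EVERY Weil factorisation `(P₀,…,P_{2n})` of `Z(X,T)` (`n ≥ 1`),
  `Pₙ ↦ (1 − q^{n/2}T)^{[n even]} · Π_{a∈𝓐}(1 − α_aT)` — «the `α`'s are the Jacobi-sum expressions» (Weil 1949 p. 507: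
  «all `α_j` have the absolute value `q^{(n−1)/2}` … this follows from the fact that the `B`'s can be expressed
  as Jacobi sums»; Ireland–Rosen Ch. 11 §3 (b)–(c) p. 167).
* §2 (`E`-level, any Galois Weil cohomology `E` over `𝔽_q` with the Lefschetz trace formula, `χ(φ) = q`, granted RH
  for `X` in `E`) **`frobAction_diagonalHypersurface_of_ne`** — `F = q^{i/2}·1` on `Hⁱ(X)` for `i ≠ n` even, `i ≤ 2n`
  (a line with `det(1 − FT) = 1 − q^{i/2}T`; Cayley–Hamilton); `frobTracePow_diagonalHypersurface_of_ne`
  (`tr(Fᵐ|Hⁱ) = q^{im/2}`), `frobTracePow_diagonalHypersurface_eq_zero` (`Hⁱ = 0` otherwise, `i ≠ n`);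
  **`neg_one_pow_mul_frobTracePow_diagonalHypersurface_middle`** — the trace formula solved for the middle degree:
  `(−1)ⁿ tr(Fᵐ | Hⁿ(X)) = N_m(X) − Σ_{j≤n, 2j≠n} q^{jm}` (Deligne (1.5.4) with `bᵢ` as above);
  **`exists_frobCharPoly_diagonalHypersurface_middle_eq_prod`** — `det(1 − FT | Hⁿ(X)) = ((1 − q^{n/2}T)^{[n even]}·P)`
  with `P ∈ ℤ[T]` and `P ↦ Π_{a∈𝓐}(1 − α_aT)` in `ℂ[T]`: the Frobenius eigenvalues on the middle cohomology are `q^{n/2}`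
  (once, `n` even) and Weil's Jacobi sums `α_a`, `a ∈ 𝓐` (Deligne 1982 §7: «the eigenvalue of `F*` acting on
  `H(V)_a` is a Jacobi sum», here for the whole characteristic polynomial).
* §2b (row g49-#10, appended; `K` carrying the characters: `χ₁ : MulChar k K` of order `d`, `ψ : AddChar k K ≠ 1`)
  **`frobCharPoly_diagonalHypersurface_middle_eq_prod`** — `det(1 − FT | Hⁿ(X)) = (1 − q^{n/2}T)^{[n even]}·Π_{a∈𝓐}(1 − α_aT)`
  in `K[T]` itself (from `Z·Π_{even}Pᵢ = Π_{odd}Pᵢ` in `K⟦T⟧`, Deligne (1.5.4), and Weil's identity over `K`), and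
  **`frobTracePow_diagonalHypersurface_middle`** — `tr(Fᵐ | Hⁿ(X)) = [n even]·q^{nm/2} + Σ_{a∈𝓐} α_aᵐ` for all `m ≥ 1`.

Not here: the decomposition of `Hⁿ` into `χ`-eigenspaces under `μ_d^{n+2}` (Deligne 1982 §7 (7.4)–(7.11)), Weil's case
`q ≢ 1 (d)`.

## References

* [Weil1949] A. Weil, Numbers of solutions of equations in finite fields, Bull. AMS 55 (1949) 497–508, p. 507.
* [IrelandRosen1990] K. Ireland, M. Rosen, GTM 84, 2nd ed. (1990), Ch. 11 §3, Thm. 2 and statements (b)–(c) p. 167.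
* [Deligne1974] P. Deligne, La conjecture de Weil. I, Publ. Math. IHÉS 43 (1974), (1.5.4), Th. (1.6), (2.3)–(2.5).
* [Deligne1982HodgeCycles] P. Deligne, Hodge cycles on abelian varieties, LNM 900 (1982), §7 (Frobenius eigenvalues on
  the Fermat hypersurface are Jacobi sums).
* Tree: `Motives/DiagonalHypersurfaceFiniteFieldCohomology` (g49-#5), `Motives/WeilConjecturesForDiagonalHypersurface`
  (g49-#3: `isWeilFactorization_of_middle_numerator`, `IsWeilFactorization.unique`), `Motives/ZetaFunctionOfDiagonalHypersurface`
  (g49-#2), `Motives/FrobeniusTrace` (`frobCharPoly_eq`, `frobTracePow`, `HasLefschetzTraceFormula`),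
  `NumberTheory/LFunctions` (`isWeilFactorization_of_isIntegralModel`).

## Provenance

Lane `lit-hodgefound` (summit `HodgeConjecture`, Track 2 foundations library, Layer B: motives / Weil cohomology over
finite fields), seat `lit-hodgefound-p29` (literature-prover, generation 49, rows g49-#9 and g49-#10 (§2b)).
-/

universe u v

open Polynomial Finset
open scoped LinearAlgebra.Projectivization
open Literature.NumberTheory.GaussSums

noncomputable section

namespace Literature.AlgebraicGeometry.Motives

open SmoothHypersurface

/-! ### §1 The middle Weil polynomial is `Π_{a∈𝓐}(1 − α_aT)` -/

section Scheme

variable {k : Type u} [Field k] [Fintype k] [DecidableEq k] {n : ℕ} [Fintype (ℙ k (Fin (n + 2) → k))]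

/-- **Weil's integer numerator is `Π_{a∈𝓐}(1 − α_aT)`**: if `P₁ ∈ ℤ[T]` satisfies Weil's identity
`Z(X,T)·Π_{j≤n}(1 − qʲT) = P₁(T)` (`n` odd) resp. `Z(X,T)·Π_{j≤n}(1 − qʲT)·P₁(T) = 1` (`n` even), then in `ℂ[T]`
`P₁ = Π_{a∈𝓐}(1 − α_aT)` with Weil's `α_a = (−1)ⁿ Πᵢχ^{aᵢ}(βᵢ⁻¹)·Σ_{ℙⁿ}Πχ^{aᵢ}(xᵢ)` for ANY complex character `χ` of
exact order `d` and any `ψ ≠ 1` (cancellation in the domain `ℚ⟦T⟧` against g49-#2's explicit identity).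
[cite: Weil1949, p. 507] [cite: IrelandRosen1990, Ch. 11 §3, Thm. 2 and (b) p. 167] -/
theorem weil1949Numerator_map_eq {d : ℕ} (hd : d ∣ Nat.card k - 1) {χ : MulChar k ℂ} (hχ : orderOf χ = d)
    (β : Fin (n + 2) → kˣ) {ψ : AddChar k ℂ} (hψ : ψ ≠ 1) {P₁ : ℤ[X]}
    (h3 : Odd n → zetaSeries (hypersurface (∑ i, MvPolynomial.C (β i : k) * MvPolynomial.X i ^ d :
        MvPolynomial (Fin (n + 2)) k)) *
      ((∏ j ∈ range (n + 1), (1 - C ((Nat.card k : ℚ) ^ j) * X) : ℚ[X]) : PowerSeries ℚ) =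
        (P₁.map (Int.castRingHom ℚ) : ℚ[X]))
    (h4 : Even n → zetaSeries (hypersurface (∑ i, MvPolynomial.C (β i : k) * MvPolynomial.X i ^ d :
        MvPolynomial (Fin (n + 2)) k)) *
      ((∏ j ∈ range (n + 1), (1 - C ((Nat.card k : ℚ) ^ j) * X) : ℚ[X]) : PowerSeries ℚ) *
        (P₁.map (Int.castRingHom ℚ) : ℚ[X]) = 1) :
    P₁.map (Int.castRingHom ℂ) =
      ∏ a ∈ (Fintype.piFinset fun _ : Fin (n + 2) ↦ range d) with (∀ i, a i ≠ 0) ∧ d ∣ ∑ i, a i,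
        (1 - C ((-1 : ℂ) ^ n * ((∏ i, (χ ^ a i) ((β i)⁻¹ : kˣ)) * jacobiSumProj (fun i ↦ χ ^ a i))) * X :
          ℂ[X]) := by
  have hd' : d ∣ Fintype.card k - 1 := by rwa [Fintype.card_eq_nat_card]
  have key : ∀ P₀ : ℚ[X], P₁.map (Int.castRingHom ℚ) = P₀ →
      P₁.map (Int.castRingHom ℂ) = P₀.map (algebraMap ℚ ℂ) := fun P₀ h => by
    rw [← h, Polynomial.map_map]
    congr 1
  rcases Nat.even_or_odd n with he | ho
  · obtain ⟨P₀, hP₀map, hZ⟩ := exists_zetaSeries_diagonalHypersurface_mul_prod_eq_of_even (K := ℂ) he hd' hχ β hψ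
    rw [Fintype.card_eq_nat_card] at hZ
    have h := h4 he
    have hne : zetaSeries (hypersurface (∑ i, MvPolynomial.C (β i : k) * MvPolynomial.X i ^ d :
          MvPolynomial (Fin (n + 2)) k)) *
        ((∏ j ∈ range (n + 1), (1 - C ((Nat.card k : ℚ) ^ j) * X) : ℚ[X]) : PowerSeries ℚ) ≠ 0 := by
      intro h0
      rw [h0, zero_mul] at h
      exact zero_ne_one h
    rw [← hP₀map]
    exact key P₀ (Polynomial.coe_inj.mp (mul_left_cancel₀ hne (h.trans hZ.symm)))
  · obtain ⟨P₀, hP₀map, hZ⟩ := exists_zetaSeries_diagonalHypersurface_mul_prod_eq_of_odd (K := ℂ) ho hd' hχ β hψ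
    rw [Fintype.card_eq_nat_card] at hZ
    rw [← hP₀map]
    exact key P₀ (Polynomial.coe_inj.mp ((h3 ho).symm.trans hZ))

/-- **The reciprocal roots of the middle Weil polynomial of the diagonal hypersurface ARE Weil's Jacobi sums**:
for every Weil factorisation `(P₀, …, P_{2n})` of `Z(X, T)` in dimension `n ≥ 1` (`X = V₊(Σβᵢxᵢ^d)`, `d ∣ q − 1`) and
every complex character `χ` of exact order `d`, `ψ ≠ 1`:
`Pₙ = (1 − q^{n/2}T)^{[n even]} · Π_{a∈𝓐}(1 − α_aT)` in `ℂ[T]` — Weil p. 507 «this follows from the fact that the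
`B`'s can be expressed as Jacobi sums», with the uniqueness of Weil factorisations (g49-#3).
[cite: Weil1949, p. 507] [cite: IrelandRosen1990, Ch. 11 §3, statements (b)–(c) p. 167] -/
theorem IsWeilFactorization.map_middle_eq_of_diagonalHypersurface {d : ℕ} {β : Fin (n + 2) → kˣ}
    {P : Fin (2 * n + 1) → ℤ[X]}
    (hW : IsWeilFactorization (Nat.card k) n
      (zetaSeries (hypersurface (∑ i, MvPolynomial.C (β i : k) * MvPolynomial.X i ^ d :
        MvPolynomial (Fin (n + 2)) k))) P)
    (hn : 0 < n) (hd : d ∣ Nat.card k - 1) {χ : MulChar k ℂ} (hχ : orderOf χ = d) {ψ : AddChar k ℂ}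
    (hψ : ψ ≠ 1) :
    (P ⟨n, by omega⟩).map (Int.castRingHom ℂ) =
      (if Even n then 1 - C ((Nat.card k : ℂ) ^ (n / 2)) * X else 1) *
        ∏ a ∈ (Fintype.piFinset fun _ : Fin (n + 2) ↦ range d) with (∀ i, a i ≠ 0) ∧ d ∣ ∑ i, a i,
          (1 - C ((-1 : ℂ) ^ n * ((∏ i, (χ ^ a i) ((β i)⁻¹ : kˣ)) * jacobiSumProj (fun i ↦ χ ^ a i))) * X :
            ℂ[X]) := by
  obtain ⟨P₁, s, h1, h2, h3, h4, -⟩ := weil1949_zetaSeries_diagonalHypersurface (n := n) hd β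
  rw [algebraMap_int_eq] at h1
  have hW₀ := isWeilFactorization_of_middle_numerator Nat.card_pos hn h1 (fun α hα => (h2 α hα).1) h3 h4
  rw [hW.unique Finite.one_lt_card hW₀]
  dsimp only
  rw [if_pos rfl, Polynomial.map_mul, weil1949Numerator_map_eq hd hχ β hψ h3 h4]
  congr 1
  split_ifs
  · rw [Polynomial.map_sub, Polynomial.map_one, Polynomial.map_mul, Polynomial.map_C, Polynomial.map_X, map_pow,
      map_natCast]
  · rw [Polynomial.map_one]

end Scheme

/-! ### §2 In a Galois Weil cohomology -/

namespace GaloisWeilCohomology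

open Literature.NumberTheory.LFunctions (isWeilFactorization_of_isIntegralModel)

section Line

variable {k : Type u} [Field k] [Finite k] {K : Type v} [Field K] [CharZero K]
  {χ : Field.absoluteGaloisGroup k →* Kˣ} (E : GaloisWeilCohomology k K χ)
variable {n d : ℕ} {β : Fin (n + 2) → kˣ}

/-- **`F = q^{i/2}` on `Hⁱ(X)` for `i ≠ n` even, `i ≤ 2n`** (`X = V₊(Σβᵢxᵢ^d)`, `d ∣ q − 1`, `n ≥ 1`): `Hⁱ(X)` is a line
with `det(1 − FT | Hⁱ) = 1 − q^{i/2}T` (g49-#5), so by Cayley–Hamilton `F` is the scalar `q^{i/2}` (Deligne (2.5):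
on `H²ⁿ`, «`F*` est la multiplication par `qⁿ`»; the class `ηʲ` spans `H^{2j}` and `F*η = qη`).  In a Galois Weil
cohomology `E` with the trace formula, `χ(φ) = q`, granted RH for `X` in `E`.
[cite: Deligne1974, (1.5.4), Th. (1.6) and (2.5)] [cite: Weil1949, p. 507] -/
theorem frobAction_diagonalHypersurface_of_ne (hE : E.HasLefschetzTraceFormula)
    (hχ : ((χ (arithFrob k) : Kˣ) : K) = Nat.card k) (hn : 0 < n) (hd : d ∣ Nat.card k - 1)
    (hRH : E.WeilRiemannHypothesisFor
      (hypersurface (∑ i, MvPolynomial.C (β i : k) * MvPolynomial.X i ^ d : MvPolynomial (Fin (n + 2)) k)) n)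
    {i : ℕ} (hi : i ≠ n) (hie : Even i) (hi2 : i ≤ 2 * n) :
    E.frobAction
        (hypersurface (∑ i, MvPolynomial.C (β i : k) * MvPolynomial.X i ^ d : MvPolynomial (Fin (n + 2)) k)) i =
      ((Nat.card k : K) ^ (i / 2)) • (1 : Module.End K (E.obj
        (hypersurface (∑ i, MvPolynomial.C (β i : k) * MvPolynomial.X i ^ d : MvPolynomial (Fin (n + 2)) k)) i)) := by
  have hX := isSmoothProjective_diagonalHypersurface_of_dvd hn hd β
  haveI := E.finite_obj hX i
  have hrank : Module.finrank K (E.obj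
      (hypersurface (∑ i, MvPolynomial.C (β i : k) * MvPolynomial.X i ^ d : MvPolynomial (Fin (n + 2)) k)) i) = 1 := by
    rw [E.finrank_diagonalHypersurface_of_ne hE hχ hn hd hRH hi, if_pos ⟨hie, hi2⟩]
  have hP := E.frobCharPoly_diagonalHypersurface_of_ne hE hχ hn hd hRH hi hi2
  rw [if_pos hie, E.frobCharPoly_eq hX i] at hP
  set F := E.frobAction
    (hypersurface (∑ i, MvPolynomial.C (β i : k) * MvPolynomial.X i ^ d : MvPolynomial (Fin (n + 2)) k)) i with hF
  have hdeg : F.charpoly.natDegree = 1 := by rw [LinearMap.charpoly_natDegree, hrank]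
  have hc0 : F.charpoly.coeff 0 = -((Nat.card k : K) ^ (i / 2)) := by
    have h1 : F.charpoly.reverse.coeff 1 = (1 - C ((Nat.card k : K) ^ (i / 2)) * X : K[X]).coeff 1 := by rw [hP]
    rwa [coeff_reverse, hdeg, revAt_le (le_refl 1), Nat.sub_self, coeff_sub, coeff_one, if_neg one_ne_zero,
      coeff_C_mul, coeff_X_one, mul_one, zero_sub] at h1
  have hCH := F.aeval_self_charpoly
  rw [F.charpoly_monic.eq_X_add_C hdeg, hc0, map_add, aeval_X, aeval_C, map_neg, Algebra.algebraMap_eq_smul_one,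
    ← sub_eq_add_neg, sub_eq_zero] at hCH
  exact hCH

/-- **`tr(Fᵐ | Hⁱ(X)) = q^{im/2}` for `i ≠ n` even, `i ≤ 2n`.** [cite: Deligne1974, (1.5.4) and (2.5)] [cite: Weil1949, p. 507] -/
theorem frobTracePow_diagonalHypersurface_of_ne (hE : E.HasLefschetzTraceFormula)
    (hχ : ((χ (arithFrob k) : Kˣ) : K) = Nat.card k) (hn : 0 < n) (hd : d ∣ Nat.card k - 1)
    (hRH : E.WeilRiemannHypothesisFor
      (hypersurface (∑ i, MvPolynomial.C (β i : k) * MvPolynomial.X i ^ d : MvPolynomial (Fin (n + 2)) k)) n)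
    {i : ℕ} (hi : i ≠ n) (hie : Even i) (hi2 : i ≤ 2 * n) (m : ℕ) :
    E.frobTracePow
        (hypersurface (∑ i, MvPolynomial.C (β i : k) * MvPolynomial.X i ^ d : MvPolynomial (Fin (n + 2)) k)) i m =
      (Nat.card k : K) ^ (i / 2 * m) := by
  have hX := isSmoothProjective_diagonalHypersurface_of_dvd hn hd β
  haveI := E.finite_obj hX i
  have hrank : Module.finrank K (E.obj
      (hypersurface (∑ i, MvPolynomial.C (β i : k) * MvPolynomial.X i ^ d : MvPolynomial (Fin (n + 2)) k)) i) = 1 := by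
    rw [E.finrank_diagonalHypersurface_of_ne hE hχ hn hd hRH hi, if_pos ⟨hie, hi2⟩]
  rw [frobTracePow, E.frobAction_diagonalHypersurface_of_ne hE hχ hn hd hRH hi hie hi2, _root_.smul_pow, one_pow,
    map_smul, LinearMap.trace_one, hrank, Nat.cast_one, smul_eq_mul, mul_one, ← pow_mul]

/-- **`tr(Fᵐ | Hⁱ(X)) = 0` for `i ≠ n` unless `i` is even and `i ≤ 2n`** (`Hⁱ(X) = 0`: `bᵢ = 0`, g49-#5).
[cite: Deligne1974, (1.5.4)] [cite: Weil1949, p. 507] -/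
theorem frobTracePow_diagonalHypersurface_eq_zero (hE : E.HasLefschetzTraceFormula)
    (hχ : ((χ (arithFrob k) : Kˣ) : K) = Nat.card k) (hn : 0 < n) (hd : d ∣ Nat.card k - 1)
    (hRH : E.WeilRiemannHypothesisFor
      (hypersurface (∑ i, MvPolynomial.C (β i : k) * MvPolynomial.X i ^ d : MvPolynomial (Fin (n + 2)) k)) n)
    {i : ℕ} (hi : i ≠ n) (h : ¬(Even i ∧ i ≤ 2 * n)) (m : ℕ) :
    E.frobTracePow
        (hypersurface (∑ i, MvPolynomial.C (β i : k) * MvPolynomial.X i ^ d : MvPolynomial (Fin (n + 2)) k)) i m =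
      0 := by
  have hX := isSmoothProjective_diagonalHypersurface_of_dvd hn hd β
  haveI := E.finite_obj hX i
  have hrank : Module.finrank K (E.obj
      (hypersurface (∑ i, MvPolynomial.C (β i : k) * MvPolynomial.X i ^ d : MvPolynomial (Fin (n + 2)) k)) i) = 0 := by
    rw [E.finrank_diagonalHypersurface_of_ne hE hχ hn hd hRH hi, if_neg h]
  haveI := Module.finrank_zero_iff.mp hrank
  have h0 : E.frobAction
      (hypersurface (∑ i, MvPolynomial.C (β i : k) * MvPolynomial.X i ^ d : MvPolynomial (Fin (n + 2)) k)) i ^ m = 0 :=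
    LinearMap.ext fun v => Subsingleton.elim _ _
  rw [frobTracePow, h0, map_zero]

/-- **The trace formula solved for the middle degree**: for every `m ≥ 1`,
`(−1)ⁿ · tr(Fᵐ | Hⁿ(X)) = N_m(X) − Σ_{j ≤ n, 2j ≠ n} q^{jm}` in `K` — the Lefschetz trace formula
`N_m = Σᵢ(−1)ⁱ tr(Fᵐ|Hⁱ)` (Deligne (1.5.4)) with `tr(Fᵐ|Hⁱ) = [i even] q^{im/2}` off the middle (the «primitive part»
of the point count).  With g49-#1 (`N_m = Σ_{j≤n} q^{jm} + (−1)ⁿ Σ_{a∈𝓐} α_aᵐ` in `ℂ`) this reads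
`tr(Fᵐ|Hⁿ) = [n even]·q^{nm/2} + Σ_{a∈𝓐} α_aᵐ`. [cite: Deligne1974, (1.5.4) and Th. (1.6)] [cite: Weil1949, p. 507] -/
theorem neg_one_pow_mul_frobTracePow_diagonalHypersurface_middle (hE : E.HasLefschetzTraceFormula)
    (hχ : ((χ (arithFrob k) : Kˣ) : K) = Nat.card k) (hn : 0 < n) (hd : d ∣ Nat.card k - 1)
    (hRH : E.WeilRiemannHypothesisFor
      (hypersurface (∑ i, MvPolynomial.C (β i : k) * MvPolynomial.X i ^ d : MvPolynomial (Fin (n + 2)) k)) n)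
    {m : ℕ} (hm : 0 < m) :
    (-1 : K) ^ n * E.frobTracePow
        (hypersurface (∑ i, MvPolynomial.C (β i : k) * MvPolynomial.X i ^ d : MvPolynomial (Fin (n + 2)) k)) n m =
      (pointCount (hypersurface (∑ i, MvPolynomial.C (β i : k) * MvPolynomial.X i ^ d :
          MvPolynomial (Fin (n + 2)) k)) m : K) -
        ∑ j ∈ (range (n + 1)).filter (fun j => 2 * j ≠ n), (Nat.card k : K) ^ (j * m) := by
  have hX := isSmoothProjective_diagonalHypersurface_of_dvd hn hd β
  have hL := hE hX m hm
  rw [← Finset.add_sum_erase _ _ (Finset.mem_range.mpr (show n < 2 * n + 1 by omega))] at hL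
  -- the terms off the middle
  have hoff : ∑ i ∈ (range (2 * n + 1)).erase n, (-1 : K) ^ i * E.frobTracePow
      (hypersurface (∑ i, MvPolynomial.C (β i : k) * MvPolynomial.X i ^ d : MvPolynomial (Fin (n + 2)) k)) i m =
      ∑ j ∈ (range (n + 1)).filter (fun j => 2 * j ≠ n), (Nat.card k : K) ^ (j * m) := by
    rw [Finset.sum_congr rfl fun i hi => (?_ :
      (-1 : K) ^ i * E.frobTracePow (hypersurface (∑ i, MvPolynomial.C (β i : k) * MvPolynomial.X i ^ d :
        MvPolynomial (Fin (n + 2)) k)) i m = if Even i then (Nat.card k : K) ^ (i / 2 * m) else 0),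
      ← Finset.sum_filter]
    · refine Finset.sum_nbij' (fun i => i / 2) (fun j => 2 * j) (fun i hi => ?_) (fun j hj => ?_) (fun i hi => ?_)
        (fun j hj => ?_) (fun i hi => ?_)
      · obtain ⟨hi, hie⟩ := Finset.mem_filter.mp hi
        obtain ⟨hin, hi2⟩ := Finset.mem_erase.mp hi
        have := Finset.mem_range.mp hi2
        refine Finset.mem_filter.mpr ⟨Finset.mem_range.mpr (by omega), fun h => hin ?_⟩
        obtain ⟨r, hr⟩ := hie
        omega
      · obtain ⟨hj, hjn⟩ := Finset.mem_filter.mp hj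
        have := Finset.mem_range.mp hj
        exact Finset.mem_filter.mpr ⟨Finset.mem_erase.mpr ⟨hjn, Finset.mem_range.mpr (by omega)⟩, ⟨j, by ring⟩⟩
      · obtain ⟨-, r, hr⟩ := Finset.mem_filter.mp hi
        omega
      · omega
      · rfl
    · obtain ⟨hin, hi2⟩ := Finset.mem_erase.mp hi
      have hi2' := Finset.mem_range.mp hi2
      by_cases hie : Even i
      · rw [if_pos hie, E.frobTracePow_diagonalHypersurface_of_ne hE hχ hn hd hRH hin hie (by omega), hie.neg_one_pow,
          one_mul]
      · rw [if_neg hie, E.frobTracePow_diagonalHypersurface_eq_zero hE hχ hn hd hRH hin (fun h => hie h.1), mul_zero]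
  rw [hoff] at hL
  rw [hL, add_sub_cancel_right]

end Line

section Middle

variable {k : Type u} [Field k] [Fintype k] [DecidableEq k] {K : Type v} [Field K] [CharZero K]
  {χ : Field.absoluteGaloisGroup k →* Kˣ} (E : GaloisWeilCohomology k K χ)
variable {n d : ℕ} [Fintype (ℙ k (Fin (n + 2) → k))] {β : Fin (n + 2) → kˣ}

/-- **The Frobenius eigenvalues on the middle cohomology of the diagonal hypersurface are Weil's Jacobi sums**:
`det(1 − FT | Hⁿ(X)) = ((1 − q^{n/2}T)^{[n even]} · P)` with `P ∈ ℤ[T]` and, for every complex character `χ₁` of exact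
order `d` and `ψ ≠ 1`, `P = Π_{a∈𝓐}(1 − α_aT)` in `ℂ[T]`, `α_a = (−1)ⁿ Πᵢχ₁^{aᵢ}(βᵢ⁻¹)·Σ_{ℙⁿ}Πχ₁^{aᵢ}(xᵢ)`
(`= (1/q)·Πᵢχ₁^{aᵢ}(βᵢ⁻¹)·Πᵢ g(χ₁^{aᵢ})`).  In a Galois Weil cohomology `E` with the trace formula, `χ(φ) = q`,
granted RH for `X` in `E` (`n ≥ 1`, `d ∣ q − 1`) — Deligne 1982 §7 reads this eigenspace by eigenspace; here for
the characteristic polynomial. [cite: Weil1949, p. 507] [cite: Deligne1982HodgeCycles, §7]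
[cite: Deligne1974, (1.5.4), Th. (1.6)] -/
theorem exists_frobCharPoly_diagonalHypersurface_middle_eq_prod (hE : E.HasLefschetzTraceFormula)
    (hχ : ((χ (arithFrob k) : Kˣ) : K) = Nat.card k) (hn : 0 < n) (hd : d ∣ Nat.card k - 1)
    (hRH : E.WeilRiemannHypothesisFor
      (hypersurface (∑ i, MvPolynomial.C (β i : k) * MvPolynomial.X i ^ d : MvPolynomial (Fin (n + 2)) k)) n)
    {χ₁ : MulChar k ℂ} (hχ₁ : orderOf χ₁ = d) {ψ : AddChar k ℂ} (hψ : ψ ≠ 1) :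
    ∃ P : ℤ[X],
      E.frobCharPoly
          (hypersurface (∑ i, MvPolynomial.C (β i : k) * MvPolynomial.X i ^ d : MvPolynomial (Fin (n + 2)) k)) n =
        ((if Even n then 1 - C ((Nat.card k : ℤ) ^ (n / 2)) * X else 1) * P).map (Int.castRingHom K) ∧
      P.map (Int.castRingHom ℂ) =
        ∏ a ∈ (Fintype.piFinset fun _ : Fin (n + 2) ↦ range d) with (∀ i, a i ≠ 0) ∧ d ∣ ∑ i, a i,
          (1 - C ((-1 : ℂ) ^ n * ((∏ i, (χ₁ ^ a i) ((β i)⁻¹ : kˣ)) * jacobiSumProj (fun i ↦ χ₁ ^ a i))) * X :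
            ℂ[X]) := by
  have hX := isSmoothProjective_diagonalHypersurface_of_dvd hn hd β
  obtain ⟨P, hP, hroots⟩ := hRH
  have hW := isWeilFactorization_of_isIntegralModel E hE hχ hX hP hroots
  obtain ⟨P₁, s, h1, h2, h3, h4, -⟩ := weil1949_zetaSeries_diagonalHypersurface (n := n) hd β
  rw [algebraMap_int_eq] at h1
  have hW₀ := isWeilFactorization_of_middle_numerator Nat.card_pos hn h1 (fun α hα => (h2 α hα).1) h3 h4
  refine ⟨P₁, ?_, weil1949Numerator_map_eq hd hχ₁ β hψ h3 h4⟩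
  have h := hP ⟨n, by omega⟩
  rw [IsIntegralModel, hW.unique Finite.one_lt_card hW₀] at h
  rw [← h]
  dsimp only
  rw [if_pos rfl]

/-- Reindexing `j ↦ 2j`: `Π_{j ≤ n} f(j) = Π_{i ≤ 2n, i even} f(i/2)` (private helper). [folklore] -/
private theorem prod_range_eq_prod_filter_even {M : Type*} [CommMonoid M] (n : ℕ) (f : ℕ → M) :
    ∏ j ∈ range (n + 1), f j = ∏ i ∈ (range (2 * n + 1)).filter Even, f (i / 2) := by
  refine Finset.prod_nbij' (fun j => 2 * j) (fun i => i / 2) (fun j hj => ?_) (fun i hi => ?_) (fun j _ => ?_)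
    (fun i hi => ?_) (fun j _ => ?_)
  · have := Finset.mem_range.mp hj
    exact Finset.mem_filter.mpr ⟨Finset.mem_range.mpr (by omega), ⟨j, by ring⟩⟩
  · obtain ⟨hi, r, hr⟩ := Finset.mem_filter.mp hi
    have := Finset.mem_range.mp hi
    exact Finset.mem_range.mpr (by omega)
  · omega
  · obtain ⟨-, r, hr⟩ := Finset.mem_filter.mp hi
    omega
  · congr 1
    omega

/-- A product of polynomials coerced to power series is the product of the coercions (private helper;
Mathlib's `Polynomial.coeToPowerSeries.ringHom`). [folklore] -/
private theorem coe_finset_prod' {R : Type*} [CommSemiring R] {ι : Type*} (s : Finset ι) (f : ι → R[X]) :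
    ((∏ i ∈ s, f i : R[X]) : PowerSeries R) = ∏ i ∈ s, ((f i : R[X]) : PowerSeries R) := by
  rw [← Polynomial.coeToPowerSeries.ringHom_apply, map_prod]
  rfl

/-- **`det(1 − FT | Hⁿ(X)) = (1 − q^{n/2}T)^{[n even]} · Π_{a∈𝓐}(1 − α_aT)` in `K[T]`** when the coefficient field `K` of
`E` carries the characters: `χ₁ : MulChar k K` of exact order `d` and `ψ : AddChar k K`, `ψ ≠ 1` (e.g. `K ⊇ ℚ(ζ_d, ζ_p)`),
`α_a = (−1)ⁿ Πᵢχ₁^{aᵢ}(βᵢ⁻¹)·Σ_{ℙⁿ}Πχ₁^{aᵢ}(xᵢ) ∈ K` — the Frobenius eigenvalues on `Hⁿ(X)` with multiplicity.  From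
the cohomological expression `Z(X,T)·Π_{i even}Pᵢ = Π_{i odd}Pᵢ` in `K⟦T⟧` (Grothendieck–Deligne (1.5.4)), the lines
`Pᵢ = 1 − q^{i/2}T` off the middle (g49-#5) and Weil's identity over `K` (g49-#2), by cancellation in the domain `K⟦T⟧`.
[cite: Deligne1974, (1.5.4), Th. (1.6)] [cite: Weil1949, p. 507] [cite: Deligne1982HodgeCycles, §7] -/
theorem frobCharPoly_diagonalHypersurface_middle_eq_prod (hE : E.HasLefschetzTraceFormula)
    (hχ : ((χ (arithFrob k) : Kˣ) : K) = Nat.card k) (hn : 0 < n) (hd : d ∣ Nat.card k - 1)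
    (hRH : E.WeilRiemannHypothesisFor
      (hypersurface (∑ i, MvPolynomial.C (β i : k) * MvPolynomial.X i ^ d : MvPolynomial (Fin (n + 2)) k)) n)
    {χ₁ : MulChar k K} (hχ₁ : orderOf χ₁ = d) {ψ : AddChar k K} (hψ : ψ ≠ 1) :
    E.frobCharPoly
        (hypersurface (∑ i, MvPolynomial.C (β i : k) * MvPolynomial.X i ^ d : MvPolynomial (Fin (n + 2)) k)) n =
      (if Even n then 1 - C ((Nat.card k : K) ^ (n / 2)) * X else 1) *
        ∏ a ∈ (Fintype.piFinset fun _ : Fin (n + 2) ↦ range d) with (∀ i, a i ≠ 0) ∧ d ∣ ∑ i, a i,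
          (1 - C ((-1 : K) ^ n * ((∏ i, (χ₁ ^ a i) ((β i)⁻¹ : kˣ)) * jacobiSumProj (fun i ↦ χ₁ ^ a i))) * X :
            K[X]) := by
  have hX := isSmoothProjective_diagonalHypersurface_of_dvd hn hd β
  have hd' : d ∣ Fintype.card k - 1 := by rwa [Fintype.card_eq_nat_card]
  have hcoh := E.zetaSeries_mul_prod_frobCharPoly_holds hE hX
  have hoff : ∀ i ∈ range (2 * n + 1), i ≠ n → E.frobCharPoly
      (hypersurface (∑ i, MvPolynomial.C (β i : k) * MvPolynomial.X i ^ d : MvPolynomial (Fin (n + 2)) k)) i =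
        if Even i then 1 - C ((Nat.card k : K) ^ (i / 2)) * X else 1 := fun i hi hin =>
    E.frobCharPoly_diagonalHypersurface_of_ne hE hχ hn hd hRH hin (by have := Finset.mem_range.mp hi; omega)
  have hD : ∏ j ∈ range (n + 1), ((1 - C ((Fintype.card k : K) ^ j) * X : K[X]) : PowerSeries K) =
      ∏ i ∈ (range (2 * n + 1)).filter Even, ((1 - C ((Nat.card k : K) ^ (i / 2)) * X : K[X]) : PowerSeries K) := by
    rw [Fintype.card_eq_nat_card]
    exact prod_range_eq_prod_filter_even n (fun j => ((1 - C ((Nat.card k : K) ^ j) * X : K[X]) : PowerSeries K))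
  apply Polynomial.coe_inj.mp
  rw [Polynomial.coe_mul, coe_finset_prod']
  rcases Nat.even_or_odd n with he | ho
  · -- `n` even: `Π_{odd} Pᵢ = 1`, `Π_{even} Pᵢ = Pₙ · Π_{i even ≠ n}(1 − q^{i/2}T)`
    rw [if_pos he]
    have hmem : n ∈ (range (2 * n + 1)).filter Even := Finset.mem_filter.mpr ⟨Finset.mem_range.mpr (by omega), he⟩
    have hodd : ∏ i ∈ (range (2 * n + 1)).filter Odd, (E.frobCharPoly
        (hypersurface (∑ i, MvPolynomial.C (β i : k) * MvPolynomial.X i ^ d : MvPolynomial (Fin (n + 2)) k)) i :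
          PowerSeries K) = 1 :=
      Finset.prod_eq_one fun i hi => by
        obtain ⟨hi, hio⟩ := Finset.mem_filter.mp hi
        have hin : i ≠ n := fun h => (Nat.not_even_iff_odd.mpr hio) (h ▸ he)
        rw [hoff i hi hin, if_neg (Nat.not_even_iff_odd.mpr hio), Polynomial.coe_one]
    have heven : ∏ i ∈ (range (2 * n + 1)).filter Even, (E.frobCharPoly
        (hypersurface (∑ i, MvPolynomial.C (β i : k) * MvPolynomial.X i ^ d : MvPolynomial (Fin (n + 2)) k)) i :
          PowerSeries K) =
        (E.frobCharPoly (hypersurface (∑ i, MvPolynomial.C (β i : k) * MvPolynomial.X i ^ d :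
          MvPolynomial (Fin (n + 2)) k)) n : PowerSeries K) *
          ∏ i ∈ ((range (2 * n + 1)).filter Even).erase n,
            ((1 - C ((Nat.card k : K) ^ (i / 2)) * X : K[X]) : PowerSeries K) := by
      rw [← Finset.mul_prod_erase _ _ hmem]
      congr 1
      refine Finset.prod_congr rfl fun i hi => ?_
      obtain ⟨hin, hi⟩ := Finset.mem_erase.mp hi
      obtain ⟨hi, hie⟩ := Finset.mem_filter.mp hi
      rw [hoff i hi hin, if_pos hie]
    have hD' : ∏ j ∈ range (n + 1), ((1 - C ((Fintype.card k : K) ^ j) * X : K[X]) : PowerSeries K) =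
        ((1 - C ((Nat.card k : K) ^ (n / 2)) * X : K[X]) : PowerSeries K) *
          ∏ i ∈ ((range (2 * n + 1)).filter Even).erase n,
            ((1 - C ((Nat.card k : K) ^ (i / 2)) * X : K[X]) : PowerSeries K) := by
      rw [hD, ← Finset.mul_prod_erase _ _ hmem]
    rw [heven, hodd] at hcoh
    have hZ' := zetaSeries_diagonalHypersurface_mul_prod_eq_of_even (K := K) he hd' hχ₁ β hψ
    rw [hD'] at hZ'
    have hne : (zetaSeries (hypersurface (∑ i, MvPolynomial.C (β i : k) * MvPolynomial.X i ^ d :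
          MvPolynomial (Fin (n + 2)) k))).map (algebraMap ℚ K) *
        ∏ i ∈ ((range (2 * n + 1)).filter Even).erase n,
          ((1 - C ((Nat.card k : K) ^ (i / 2)) * X : K[X]) : PowerSeries K) ≠ 0 := by
      intro h0
      have : (zetaSeries (hypersurface (∑ i, MvPolynomial.C (β i : k) * MvPolynomial.X i ^ d :
          MvPolynomial (Fin (n + 2)) k))).map (algebraMap ℚ K) *
        ((E.frobCharPoly (hypersurface (∑ i, MvPolynomial.C (β i : k) * MvPolynomial.X i ^ d :
          MvPolynomial (Fin (n + 2)) k)) n : PowerSeries K) *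
          ∏ i ∈ ((range (2 * n + 1)).filter Even).erase n,
            ((1 - C ((Nat.card k : K) ^ (i / 2)) * X : K[X]) : PowerSeries K)) = 0 := by
        calc _ = (E.frobCharPoly (hypersurface (∑ i, MvPolynomial.C (β i : k) * MvPolynomial.X i ^ d :
              MvPolynomial (Fin (n + 2)) k)) n : PowerSeries K) *
            ((zetaSeries (hypersurface (∑ i, MvPolynomial.C (β i : k) * MvPolynomial.X i ^ d :
              MvPolynomial (Fin (n + 2)) k))).map (algebraMap ℚ K) *
              ∏ i ∈ ((range (2 * n + 1)).filter Even).erase n,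
                ((1 - C ((Nat.card k : K) ^ (i / 2)) * X : K[X]) : PowerSeries K)) := by ring
          _ = 0 := by rw [h0, mul_zero]
      rw [this] at hcoh
      exact zero_ne_one hcoh
    refine mul_left_cancel₀ hne ?_
    calc (zetaSeries (hypersurface (∑ i, MvPolynomial.C (β i : k) * MvPolynomial.X i ^ d :
          MvPolynomial (Fin (n + 2)) k))).map (algebraMap ℚ K) *
        (∏ i ∈ ((range (2 * n + 1)).filter Even).erase n,
          ((1 - C ((Nat.card k : K) ^ (i / 2)) * X : K[X]) : PowerSeries K)) *
        (E.frobCharPoly (hypersurface (∑ i, MvPolynomial.C (β i : k) * MvPolynomial.X i ^ d :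
          MvPolynomial (Fin (n + 2)) k)) n : PowerSeries K)
        = 1 := by rw [← hcoh]; ring
      _ = _ := by rw [← hZ']; ring
  · -- `n` odd: `Π_{odd} Pᵢ = Pₙ`, `Π_{even} Pᵢ = Π_{j≤n}(1 − qʲT)`
    rw [if_neg (Nat.not_even_iff_odd.mpr ho), Polynomial.coe_one, one_mul]
    have hmem : n ∈ (range (2 * n + 1)).filter Odd := Finset.mem_filter.mpr ⟨Finset.mem_range.mpr (by omega), ho⟩
    have hodd : ∏ i ∈ (range (2 * n + 1)).filter Odd, (E.frobCharPoly
        (hypersurface (∑ i, MvPolynomial.C (β i : k) * MvPolynomial.X i ^ d : MvPolynomial (Fin (n + 2)) k)) i :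
          PowerSeries K) =
        (E.frobCharPoly (hypersurface (∑ i, MvPolynomial.C (β i : k) * MvPolynomial.X i ^ d :
          MvPolynomial (Fin (n + 2)) k)) n : PowerSeries K) :=
      Finset.prod_eq_single_of_mem n hmem fun i hi hin => by
        obtain ⟨hi, hio⟩ := Finset.mem_filter.mp hi
        rw [hoff i hi hin, if_neg (Nat.not_even_iff_odd.mpr hio), Polynomial.coe_one]
    have heven : ∏ i ∈ (range (2 * n + 1)).filter Even, (E.frobCharPoly
        (hypersurface (∑ i, MvPolynomial.C (β i : k) * MvPolynomial.X i ^ d : MvPolynomial (Fin (n + 2)) k)) i :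
          PowerSeries K) =
        ∏ j ∈ range (n + 1), ((1 - C ((Fintype.card k : K) ^ j) * X : K[X]) : PowerSeries K) := by
      rw [hD]
      refine Finset.prod_congr rfl fun i hi => ?_
      obtain ⟨hi, hie⟩ := Finset.mem_filter.mp hi
      have hin : i ≠ n := fun h => (Nat.not_even_iff_odd.mpr ho) (h ▸ hie)
      rw [hoff i hi hin, if_pos hie]
    rw [heven, hodd, zetaSeries_diagonalHypersurface_mul_prod_eq_of_odd (K := K) ho hd' hχ₁ β hψ] at hcoh
    exact hcoh.symm

/-- **`tr(Fᵐ | Hⁿ(X)) = [n even]·q^{nm/2} + Σ_{a∈𝓐} α_aᵐ` for every `m ≥ 1`** — the Frobenius eigenvalues on the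
middle cohomology as power sums, when the coefficient field `K` of `E` carries the characters (`χ₁ : MulChar k K` of
exact order `d`, `ψ : AddChar k K`, `ψ ≠ 1`): the trace formula solved for `Hⁿ`
(`neg_one_pow_mul_frobTracePow_diagonalHypersurface_middle`) combined with Weil's count
`N_m = Σ_{j≤n} q^{jm} + (−1)ⁿ Σ_{a∈𝓐} α_aᵐ` (g49-#1). [cite: Weil1949, p. 507] [cite: Deligne1974, (1.5.4)]
[cite: IrelandRosen1990, Ch. 11 §3, (6) and (b)–(c) p. 167] -/
theorem frobTracePow_diagonalHypersurface_middle (hE : E.HasLefschetzTraceFormula)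
    (hχ : ((χ (arithFrob k) : Kˣ) : K) = Nat.card k) (hn : 0 < n) (hd : d ∣ Nat.card k - 1)
    (hRH : E.WeilRiemannHypothesisFor
      (hypersurface (∑ i, MvPolynomial.C (β i : k) * MvPolynomial.X i ^ d : MvPolynomial (Fin (n + 2)) k)) n)
    {χ₁ : MulChar k K} (hχ₁ : orderOf χ₁ = d) {ψ : AddChar k K} (hψ : ψ ≠ 1) {m : ℕ} (hm : 0 < m) :
    E.frobTracePow
        (hypersurface (∑ i, MvPolynomial.C (β i : k) * MvPolynomial.X i ^ d : MvPolynomial (Fin (n + 2)) k)) n m =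
      (if Even n then (Nat.card k : K) ^ (n / 2 * m) else 0) +
        ∑ a ∈ (Fintype.piFinset fun _ : Fin (n + 2) ↦ range d) with (∀ i, a i ≠ 0) ∧ d ∣ ∑ i, a i,
          ((-1 : K) ^ n * ((∏ i, (χ₁ ^ a i) ((β i)⁻¹ : kˣ)) * jacobiSumProj (fun i ↦ χ₁ ^ a i))) ^ m := by
  have hd' : d ∣ Fintype.card k - 1 := by rwa [Fintype.card_eq_nat_card]
  have h9 := E.neg_one_pow_mul_frobTracePow_diagonalHypersurface_middle hE hχ hn hd hRH hm
  have h1 := pointCount_diagonalHypersurface_eq_sum_pow (K := K) hd' hχ₁ β hψ hm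
  rw [Fintype.card_eq_nat_card] at h1
  -- split `Σ_{j ≤ n} q^{jm}` at `j = n/2`
  have hsplit : ∑ j ∈ range (n + 1), ((Nat.card k : K) ^ j) ^ m =
      (∑ j ∈ (range (n + 1)).filter (fun j => 2 * j ≠ n), (Nat.card k : K) ^ (j * m)) +
        (if Even n then (Nat.card k : K) ^ (n / 2 * m) else 0) := by
    rw [Finset.sum_congr rfl fun j _ => (pow_mul (Nat.card k : K) j m).symm]
    rcases Nat.even_or_odd n with he | ho
    · rw [if_pos he]
      have hmem : n / 2 ∈ range (n + 1) := Finset.mem_range.mpr (by omega)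
      have hfilt : (range (n + 1)).filter (fun j => 2 * j ≠ n) = (range (n + 1)).erase (n / 2) := by
        ext j
        simp only [Finset.mem_filter, Finset.mem_erase, Finset.mem_range]
        obtain ⟨r, hr⟩ := he
        constructor
        · rintro ⟨hj, hne⟩
          exact ⟨fun h => hne (by omega), hj⟩
        · rintro ⟨hne, hj⟩
          exact ⟨hj, fun h => hne (by omega)⟩
      rw [hfilt, Finset.sum_erase_add _ _ hmem]
    · have hfilt : (range (n + 1)).filter (fun j => 2 * j ≠ n) = range (n + 1) :=
        Finset.filter_true_of_mem fun j _ h => (Nat.not_even_iff_odd.mpr ho) ⟨j, by omega⟩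
      rw [if_neg (Nat.not_even_iff_odd.mpr ho), add_zero, hfilt]
  rw [h1, hsplit] at h9
  -- `(−1)ⁿ·tr = ite + (−1)ⁿ Σ α^m`; multiply by `(−1)ⁿ`
  have hsq : (-1 : K) ^ n * (-1) ^ n = 1 := by rw [← pow_add, ← two_mul, pow_mul, neg_one_sq, one_pow]
  have key : E.frobTracePow
      (hypersurface (∑ i, MvPolynomial.C (β i : k) * MvPolynomial.X i ^ d : MvPolynomial (Fin (n + 2)) k)) n m =
      (-1 : K) ^ n * ((-1 : K) ^ n * E.frobTracePow
        (hypersurface (∑ i, MvPolynomial.C (β i : k) * MvPolynomial.X i ^ d : MvPolynomial (Fin (n + 2)) k)) n m) := by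
    rw [← mul_assoc, hsq, one_mul]
  rw [key, h9]
  rcases Nat.even_or_odd n with he | ho
  · rw [if_pos he, he.neg_one_pow]
    ring
  · rw [if_neg (Nat.not_even_iff_odd.mpr ho), ho.neg_one_pow]
    ring

end Middle

end GaloisWeilCohomology

end Literature.AlgebraicGeometry.Motives
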